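import Mathlib
import Summits.HubbardSuperconductivity.HubbardSuperconductivity.Theorems.LevyLogBootstrapBlock2InfDivXXZFourCheckB

/-!
# Crux `Block2InfDivXXZ` (stmt-HubbardSuperconductivity-15048), `M = 4` slice: kernel facts,
# orbit table (words and global part)
-/

set_option linter.dupNamespace false
set_option linter.style.longLine false

namespace Summit.HubbardSuperconductivity.HubbardSuperconductivity.Theorems.LevyLogBootstrap

namespace FourCert

set_option maxRecDepth 100000
/-- `tableCheckWords` holds. -/
theorem fact_words : tableCheckWords = true := by decide +kernel
/-- `tableCheckGlobal` holds. -/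
theorem fact_global : tableCheckGlobal = true := by decide +kernel

end FourCert

end Summit.HubbardSuperconductivity.HubbardSuperconductivity.Theorems.LevyLogBootstrap
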